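import Summits.AtomisticToContinuum.FouriersLaw.Theorems.BondHeatUncertaintySubdiffusiveBondHeatIffBoundedResponse
import Summits.AtomisticToContinuum.FouriersLaw.Theorems.BondHeatUncertaintySubdiffusiveBondHeatDeficitCesaroLinear
import Summits.AtomisticToContinuum.FouriersLaw.Theorems.BondHeatUncertaintySubdiffusiveBondHeatTransientFormula
import Summits.AtomisticToContinuum.FouriersLaw.Theorems.FourierGreenKuboFourierFiniteResponseOfUnique
import Summits.AtomisticToContinuum.FouriersLaw.Theses.ResponseFloorAndLimit

/-!
# FouriersLaw N_F · node «ThoulessBudgetLadder», part A: the RUNGS and seams 1–3 (lens-1 g52; split for the ≤ 400-line rule)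

File A of the two-file landing of lens-1 g52's node «ThoulessBudgetLadder» (node sha256 dc5b68c9…, critic row 655): the two rungs
`ThoulessBudget` (TB) / `LateBudget` (LB), the two typed fixed-`N` / floor inputs of seam 4 (`FixedNAffineBathBondCeiling`,
`ContactOhmicFloor`), and seams 1–3 (`9120 ⟹ TB ⟹ LB`, `LB ⟹ BoundedResponse` through (★)/(K)).  Part B
(`…SubdiffusiveBondHeatThoulessBudgetLadder`, same namespace, carrying the node's full module documentation) has seams 4–7.
Every declaration keeps its fully-qualified name; bodies byte-identical to the node.
-/

noncomputable section

open MeasureTheory Filter Topology Set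
open Literature.MathematicalPhysics.KineticTheory.HeatConduction

namespace Summit.AtomisticToContinuum.FouriersLaw.Theorems.SubdiffusiveBondHeat.ThoulessBudgetLadder

open Summit.AtomisticToContinuum.FouriersLaw.Theses.BondHeatUncertainty
  (SubdiffusiveBondHeat ExtensiveSnapshotIrreversibility LinearResponseFTUR NessUnique BoundedResponse)

/-! ## The two rungs (typed over the item's own `let`s) -/

/-- **Thouless-time budget** (TB): for all parameters `> 0` and `T > 0` there are `A`, `c > 0`, `N₀` such that for
`N ≥ N₀` some bond `b` (`b+1 < N`) has `V_N(b, cN²) ≤ A·N` — the value of 9120's functional at the single time `t = cN²`,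
with the Ohmic budget `A·N = (A/c)·t/N` and no statement at any other time. -/
def ThoulessBudget : Prop :=
  ∀ ω₂ lam β γ : ℝ, 0 < ω₂ → 0 < lam → 0 < β → 0 < γ → ∀ T : ℝ, 0 < T →
    (let P := pinnedChain ω₂ lam β γ
     let C : ℕ → ℕ → ℝ → ℝ := fun N b s => if h : b < N then ∫ z, P.bondCurrent N ⟨b, h⟩ z *
       (∫ y, P.bondCurrent N ⟨b, h⟩ y ∂(P.transitionKernel N T T s.toNNReal z)) ∂(P.gibbsMeasure N T) else 0
     let V : ℕ → ℕ → ℝ → ℝ := fun N b t => 2 * ∫ s in (0 : ℝ)..t, (t - s) * C N b s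
     ∃ A c : ℝ, 0 < c ∧ ∃ N₀ : ℕ, ∀ N : ℕ, N₀ ≤ N → ∃ b : ℕ, b + 1 < N ∧
       V N b (c * (N : ℝ) ^ 2) ≤ A * (N : ℝ))

/-- **Late budget** (LB): for all parameters `> 0` and `T > 0` there are `A`, `c > 0`, `N₀` such that for `N ≥ N₀` some
bond `b` (`b+1 < N`) and SOME time `t ≥ cN²` have `V_N(b,t) ≤ A·t/N` — an Ohmic variance budget at one late time.  By the
flat Kubo–KDN identity `V_N(b,t)/t → 2T²G_N` (`t → ∞`, fixed `N`) this is bounded response in equilibrium-variance clothing;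
seams 3–5 make that precise with tree theorems only. -/
def LateBudget : Prop :=
  ∀ ω₂ lam β γ : ℝ, 0 < ω₂ → 0 < lam → 0 < β → 0 < γ → ∀ T : ℝ, 0 < T →
    (let P := pinnedChain ω₂ lam β γ
     let C : ℕ → ℕ → ℝ → ℝ := fun N b s => if h : b < N then ∫ z, P.bondCurrent N ⟨b, h⟩ z *
       (∫ y, P.bondCurrent N ⟨b, h⟩ y ∂(P.transitionKernel N T T s.toNNReal z)) ∂(P.gibbsMeasure N T) else 0
     let V : ℕ → ℕ → ℝ → ℝ := fun N b t => 2 * ∫ s in (0 : ℝ)..t, (t - s) * C N b s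
     ∃ A c : ℝ, 0 < c ∧ ∃ N₀ : ℕ, ∀ N : ℕ, N₀ ≤ N → ∃ b : ℕ, b + 1 < N ∧
       ∃ t : ℝ, c * (N : ℝ) ^ 2 ≤ t ∧ V N b t ≤ A * t / (N : ℝ))

/-! ## The two fixed-`N` / floor inputs of seam 4, BY STATEMENT (landed theorems; discharged by name in the FULL file) -/

/-- (H1) **Fixed-`N` affine ceiling at the bath bond with the Ohm-free slope.**  For every `N ≥ 2` there is `B_N` with
`V_N(0,t) ≤ 4γT²·E_N·t + B_N` for all `t ≥ 0`, `E_N = 1 − (γ/T²)∫₀^∞K_N` the boundary escape deficit.  (= landed bath-bond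
reduction `stub_bathBondReduction_of_kernelFacts` ∘ `stub_kernelDetailedBalance`/`stub_siteEnergyDynkin`/
`stub_siteEnergyCurrentCovariance` + `pinnedChain_transientIntegral_le_fixedN` + `localEnergyMoment`; FULL file:
`fixedNAffineBathBondCeiling_holds`.)  Nothing `N`-uniform is claimed about `B_N`. -/
def FixedNAffineBathBondCeiling : Prop :=
  ∀ ω₂ lam β γ : ℝ, 0 < ω₂ → 0 < lam → 0 < β → 0 < γ → ∀ T : ℝ, 0 < T → ∀ (N : ℕ) (hN : 1 < N),
    ∃ B : ℝ, ∀ t : ℝ, 0 ≤ t →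
      2 * (∫ s in (0 : ℝ)..t, (t - s) *
          ∫ z, (pinnedChain ω₂ lam β γ).bondCurrent N ⟨0, Nat.zero_lt_of_lt hN⟩ z *
              (∫ y, (pinnedChain ω₂ lam β γ).bondCurrent N ⟨0, Nat.zero_lt_of_lt hN⟩ y
                ∂((pinnedChain ω₂ lam β γ).transitionKernel N T T s.toNNReal z))
            ∂((pinnedChain ω₂ lam β γ).gibbsMeasure N T)) ≤
        4 * γ * T ^ 2 * (1 - γ / T ^ 2 * ∫ u in Set.Ioi (0 : ℝ),
            ∫ z, ((z.2 ⟨0, Nat.zero_lt_of_lt hN⟩) ^ 2 - T) *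
                (∫ y, ((y.2 ⟨0, Nat.zero_lt_of_lt hN⟩) ^ 2 - T)
                  ∂((pinnedChain ω₂ lam β γ).transitionKernel N T T u.toNNReal z))
              ∂((pinnedChain ω₂ lam β γ).gibbsMeasure N T)) * t + B

/-- (H2) **Contact Ohmic floor**: `E_N ≤ C₁/N` for `N ≥ N₀` — verbatim the conclusion of the landed
`ohmicFloor_of_boundedResponse : BoundedResponse → ContactOhmicFloor` (response identity `D_N = (N−1)γE_N`; the converse
`boundedResponse_of_ohmicFloor` is landed too, so H2 ⟺ BoundedResponse). -/
def ContactOhmicFloor : Prop :=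
  ∀ ω₂ lam β γ : ℝ, 0 < ω₂ → 0 < lam → 0 < β → 0 < γ → ∀ T : ℝ, 0 < T →
    ∃ C₁ : ℝ, ∃ N₀ : ℕ, ∀ N : ℕ, N₀ ≤ N →
      1 - γ / T ^ 2 * (∫ u in Set.Ioi (0 : ℝ),
        if h : 0 < N then
          ∫ z, ((z.2 ⟨0, h⟩) ^ 2 - T) *
              (∫ y, ((y.2 ⟨0, h⟩) ^ 2 - T) ∂((pinnedChain ω₂ lam β γ).transitionKernel N T T u.toNNReal z))
            ∂((pinnedChain ω₂ lam β γ).gibbsMeasure N T)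
        else 0) ≤ C₁ / (N : ℝ)

/-! ## Seams 1–2: 9120 ⟹ TB ⟹ LB -/

/-- **(S) ⟹ TB**: specialise the window law at its endpoint `t = cN²` (admissible once `cN ≥ 1`), `A√(cN²) = A√c·N`.
[folklore] -/
theorem thoulessBudget_of_subdiffusiveBondHeat : SubdiffusiveBondHeat → ThoulessBudget := by
  intro hS ω₂ lam β γ hω hl hβ hγ T hT P C V
  obtain ⟨A, c, hc, N₀, hSN⟩ := hS ω₂ lam β γ hω hl hβ hγ T hT
  refine ⟨A * Real.sqrt c, c, hc, max N₀ (⌈1 / c⌉₊ + 1), fun N hN => ?_⟩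
  have hN₀ : N₀ ≤ N := le_trans (le_max_left _ _) hN
  have hNc : ⌈1 / c⌉₊ + 1 ≤ N := le_trans (le_max_right _ _) hN
  have hNpos : (0 : ℝ) < N := by exact_mod_cast (show 0 < N by omega)
  have hcN : 1 ≤ c * (N : ℝ) := by
    have h1 : (1 / c : ℝ) ≤ ⌈1 / c⌉₊ := Nat.le_ceil _
    have h2 : (⌈1 / c⌉₊ : ℝ) + 1 ≤ N := by exact_mod_cast hNc
    have h3 : 1 / c ≤ (N : ℝ) := by linarith
    rw [div_le_iff₀ hc] at h3
    linarith
  obtain ⟨b, hb, hV⟩ := hSN N hN₀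
  refine ⟨b, hb, ?_⟩
  have hN1 : (1 : ℝ) ≤ N := by exact_mod_cast (show 1 ≤ N by omega)
  have ht1 : 1 ≤ c * (N : ℝ) ^ 2 := by
    have : c * (N : ℝ) ≤ c * (N : ℝ) ^ 2 := by nlinarith
    linarith
  have hsqrt : Real.sqrt (c * (N : ℝ) ^ 2) = Real.sqrt c * (N : ℝ) := by
    rw [Real.sqrt_mul hc.le, Real.sqrt_sq hNpos.le]
  have key := hV (c * (N : ℝ) ^ 2) ht1 le_rfl
  rw [hsqrt] at key
  calc V N b (c * (N : ℝ) ^ 2) ≤ A * (Real.sqrt c * (N : ℝ)) := key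
    _ = A * Real.sqrt c * (N : ℝ) := by ring

/-- **TB ⟹ LB**: take `t = cN²`; `A·N ≤ (A⁺/c)·t/N`. [folklore] -/
theorem lateBudget_of_thoulessBudget : ThoulessBudget → LateBudget := by
  intro hTB ω₂ lam β γ hω hl hβ hγ T hT P C V
  obtain ⟨A, c, hc, N₀, h⟩ := hTB ω₂ lam β γ hω hl hβ hγ T hT
  refine ⟨max A 0 / c, c, hc, max N₀ 1, fun N hN => ?_⟩
  have hN₀ : N₀ ≤ N := le_trans (le_max_left _ _) hN
  have hNpos : (0 : ℝ) < N := by exact_mod_cast (show 0 < N by omega)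
  obtain ⟨b, hb, hV⟩ := h N hN₀
  refine ⟨b, hb, c * (N : ℝ) ^ 2, le_rfl, ?_⟩
  have e : max A 0 / c * (c * (N : ℝ) ^ 2) / (N : ℝ) = max A 0 * (N : ℝ) := by
    field_simp
  rw [e]
  exact hV.trans (mul_le_mul_of_nonneg_right (le_max_left _ _) hNpos.le)

/-! ## Seam 3: LB ⟹ BoundedResponse through (★) and (K) — the transfer needs only the late budget -/

/-- `a x² ≤ P x + Q` with `a > 0`, `Q ≥ 0` forces `x ≤ max 1 ((P+Q)/a)` (local copy of the transfer file's lemma). -/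
private theorem le_max_of_quadratic_le' {x a P Q : ℝ} (ha : 0 < a) (hQ : 0 ≤ Q) (h : a * x ^ 2 ≤ P * x + Q) :
    x ≤ max 1 ((P + Q) / a) := by
  by_cases hx : x ≤ 1
  · exact hx.trans (le_max_left _ _)
  · push Not at hx
    have hx0 : 0 < x := by linarith
    have h1 : a * x ≤ P + Q := by
      have hQx : Q ≤ Q * x := by nlinarith
      have : a * x * x ≤ (P + Q) * x := by nlinarith
      exact le_of_mul_le_mul_right this hx0
    have : x ≤ (P + Q) / a := by
      rw [le_div_iff₀ ha]; linarith [mul_comm a x]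
    exact this.trans (le_max_right _ _)

/-- **Abstract late-budget transfer.**  Response coefficients `D`, an abstract variance functional `V`, an abstract
snapshot irreversibility `kl`; if (LB) for `N ≥ N₀` some bond has `V N b t ≤ A t/N` at some `t ≥ cN²`, (K) `kl N δ ≤ C N δ²`
eventually, and (★) `2(D_N/(N−1))²t² ≤ V N b t (D_N/(N−1)·t/T² + K)` for `N ≥ 2`, every bond, `t > 0`, `K ≥ 0` with
`kl N δ ≤ Kδ²` eventually (and `0 ≤ D_N`) — then `|D_N|` is bounded: `x = N·D_N/(N−1)` obeys `2x² ≤ (A⁺/T²)x + A⁺C⁺/c`.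
Compare the landed `bddAbove_abs_of_transfer` (hypothesis `∀ t ∈ [1,cN²], V ≤ A√t`, of which it uses `t = cN²` only).
[folklore] -/
theorem bddAbove_abs_of_lateBudget {D : ℕ → ℝ} {V : ℕ → ℕ → ℝ → ℝ} {kl : ℕ → ℝ → ENNReal}
    {A c C T : ℝ} {N₀ : ℕ} (hc : 0 < c) (hT : 0 < T)
    (hS : ∀ N : ℕ, N₀ ≤ N → ∃ b : ℕ, b + 1 < N ∧
      ∃ t : ℝ, c * (N : ℝ) ^ 2 ≤ t ∧ V N b t ≤ A * t / (N : ℝ))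
    (hK : ∀ N : ℕ, ∀ᶠ δ in nhdsWithin (0 : ℝ) {(0 : ℝ)}ᶜ, kl N δ ≤ ENNReal.ofReal (C * (N : ℝ) * δ ^ 2))
    (hF : ∀ N : ℕ, 2 ≤ N → 0 ≤ D N ∧ ∀ b : ℕ, b + 1 < N → ∀ t : ℝ, 0 < t → ∀ K : ℝ, 0 ≤ K →
      (∀ᶠ δ in nhdsWithin (0 : ℝ) {(0 : ℝ)}ᶜ, kl N δ ≤ ENNReal.ofReal (K * δ ^ 2)) →
      2 * (D N / ((N : ℝ) - 1)) ^ 2 * t ^ 2 ≤ V N b t * (D N / ((N : ℝ) - 1) * t / T ^ 2 + K)) :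
    BddAbove (Set.range fun N => |D N|) := by
  set A' : ℝ := max A 0 with hA'
  set C' : ℝ := max C 0 with hC'
  have hA'0 : 0 ≤ A' := le_max_right _ _
  have hC'0 : 0 ≤ C' := le_max_right _ _
  set P : ℝ := A' / T ^ 2 with hP
  set Q : ℝ := A' * C' / c with hQ
  have hQ0 : 0 ≤ Q := by positivity
  set B : ℝ := max 1 ((P + Q) / 2) with hB
  set M : ℕ := max N₀ 2 with hM
  have hbound : ∀ N : ℕ, M ≤ N → |D N| ≤ B := by
    intro N hN
    have hN₀ : N₀ ≤ N := le_trans (le_max_left _ _) hN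
    have hN2 : 2 ≤ N := le_trans (le_max_right _ _) hN
    have hN2r : (2 : ℝ) ≤ N := by exact_mod_cast hN2
    have hNpos : (0 : ℝ) < N := by linarith
    -- the late time and its budget
    obtain ⟨b, hb, t, hct, hVt⟩ := hS N hN₀
    have hcN2 : 0 < c * (N : ℝ) ^ 2 := by positivity
    have htpos : 0 < t := lt_of_lt_of_le hcN2 hct
    have hVt' : V N b t ≤ A' * t / (N : ℝ) := by
      refine hVt.trans ?_
      have : A * t ≤ A' * t := mul_le_mul_of_nonneg_right (le_max_left _ _) htpos.le
      exact div_le_div_of_nonneg_right this hNpos.le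
    -- the FTUR at K = C' N
    obtain ⟨hD0, hFb⟩ := hF N hN2
    have hKN : ∀ᶠ δ in nhdsWithin (0 : ℝ) {(0 : ℝ)}ᶜ, kl N δ ≤ ENNReal.ofReal (C' * (N : ℝ) * δ ^ 2) := by
      filter_upwards [hK N] with δ hδ
      refine hδ.trans (ENNReal.ofReal_le_ofReal ?_)
      have : C * (N : ℝ) ≤ C' * (N : ℝ) := mul_le_mul_of_nonneg_right (le_max_left _ _) hNpos.le
      nlinarith [sq_nonneg δ]
    have hKN0 : 0 ≤ C' * (N : ℝ) := mul_nonneg hC'0 hNpos.le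
    have hin := hFb b hb t htpos (C' * (N : ℝ)) hKN0 hKN
    -- conductance G = D_N/(N-1) ≥ 0
    set G : ℝ := D N / ((N : ℝ) - 1) with hG
    have hG0 : 0 ≤ G := div_nonneg hD0 (by linarith)
    have hf0 : 0 ≤ G * t / T ^ 2 + C' * (N : ℝ) := by positivity
    have h3 : 2 * G ^ 2 * t ^ 2 ≤ A' * t / (N : ℝ) * (G * t / T ^ 2 + C' * (N : ℝ)) :=
      hin.trans (mul_le_mul_of_nonneg_right hVt' hf0)
    -- divide by t: 2 G² t ≤ A' G t/(N T²) + A' C'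
    have h4 : 2 * G ^ 2 * t ≤ A' * G * t / ((N : ℝ) * T ^ 2) + A' * C' := by
      have e1 : 2 * G ^ 2 * t ^ 2 = t * (2 * G ^ 2 * t) := by ring
      have e2 : A' * t / (N : ℝ) * (G * t / T ^ 2 + C' * (N : ℝ)) =
          t * (A' * G * t / ((N : ℝ) * T ^ 2) + A' * C') := by
        field_simp
      rw [e1, e2] at h3
      exact le_of_mul_le_mul_left h3 htpos
    -- multiply by N²/t: 2 x² ≤ P x + A' C' N²/t ≤ P x + Q
    set x : ℝ := G * (N : ℝ) with hx
    have hratio : (N : ℝ) ^ 2 / t ≤ 1 / c := by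
      rw [div_le_div_iff₀ htpos hc, one_mul]
      linarith [hct]
    have h5 : (N : ℝ) ^ 2 / t * (2 * G ^ 2 * t) ≤
        (N : ℝ) ^ 2 / t * (A' * G * t / ((N : ℝ) * T ^ 2) + A' * C') :=
      mul_le_mul_of_nonneg_left h4 (by positivity)
    have e3 : (N : ℝ) ^ 2 / t * (2 * G ^ 2 * t) = 2 * x ^ 2 := by
      simp only [hx]; field_simp
    have e4 : (N : ℝ) ^ 2 / t * (A' * G * t / ((N : ℝ) * T ^ 2) + A' * C') =
        P * x + A' * C' * ((N : ℝ) ^ 2 / t) := by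
      simp only [hx, hP]; field_simp
    rw [e3, e4] at h5
    have h6 : A' * C' * ((N : ℝ) ^ 2 / t) ≤ Q := by
      have := mul_le_mul_of_nonneg_left hratio (mul_nonneg hA'0 hC'0)
      calc A' * C' * ((N : ℝ) ^ 2 / t) ≤ A' * C' * (1 / c) := this
        _ = Q := by simp only [hQ]; ring
    have hq : 2 * x ^ 2 ≤ P * x + Q := by linarith
    have hxB : x ≤ B := le_max_of_quadratic_le' (by norm_num) hQ0 hq
    -- 0 ≤ D_N = G (N-1) ≤ G N = x
    have hDx : D N ≤ x := by
      have hDG : D N = G * ((N : ℝ) - 1) := by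
        rw [hG, div_mul_cancel₀]
        exact ne_of_gt (by linarith)
      rw [hDG, hx]; nlinarith
    rw [abs_of_nonneg hD0]
    exact hDx.trans hxB
  have hbu : IsBoundedUnder (· ≤ ·) atTop fun N => |D N| := ⟨B, eventually_atTop.2 ⟨M, hbound⟩⟩
  exact hbu.bddAbove_range

/-- **LB ⟹ BoundedResponse given (K), (★) and weak-NESS uniqueness** — same shape as the route's proved transfer
`TransferToBoundedResponse` (9655) with (S) replaced by the late budget. [folklore] -/
theorem boundedResponse_of_lateBudget :
    LateBudget → ExtensiveSnapshotIrreversibility → LinearResponseFTUR → NessUnique → BoundedResponse := by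
  intro hS hK hF hU ω₂ lam β γ hω hl hβ hγ μ hμ T hT D hD
  have huniq := hU ω₂ lam β γ hω hl hβ hγ
  obtain ⟨C, hC⟩ := hK ω₂ lam β γ hω hl hβ hγ huniq μ hμ T hT
  obtain ⟨A, c, hc, N₀, hSN⟩ := hS ω₂ lam β γ hω hl hβ hγ T hT
  have hFN := hF ω₂ lam β γ hω hl hβ hγ huniq μ hμ T hT D hD
  exact bddAbove_abs_of_lateBudget hc hT hSN hC hFN

/-- The same with `NessUnique` (0741) discharged by its landed proof (`EmbeddedDrudeMourre.nessUnique_proof`; the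
`NessUnique` decls of all FouriersLaw routes are syntactically identical). [folklore] -/
theorem boundedResponse_of_lateBudget' :
    LateBudget → ExtensiveSnapshotIrreversibility → LinearResponseFTUR → BoundedResponse := fun hL hK hF =>
  boundedResponse_of_lateBudget hL hK hF Summit.AtomisticToContinuum.FouriersLaw.Theorems.nessUnique_proof

/-- **LB ⟹ (K) ⟹ BoundedResponse**, with (★) (`LinearResponseFTUR_proof`, item 9122) and `NessUnique` (0741) discharged by
their landed proofs. [folklore] -/
theorem boundedResponse_of_lateBudget_of_snapshot :
    LateBudget → ExtensiveSnapshotIrreversibility → BoundedResponse := fun hL hK =>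
  boundedResponse_of_lateBudget' hL hK Summit.AtomisticToContinuum.FouriersLaw.Theorems.LinearResponseFTUR_proof

end Summit.AtomisticToContinuum.FouriersLaw.Theorems.SubdiffusiveBondHeat.ThoulessBudgetLadder

end
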